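import Literature.AlgebraicGeometry.Resolution.RankOneReductionProofs
import Literature.AlgebraicGeometry.Resolution.LocalUniformization
import HarnessLib

/-!
# Novacoski–Spivakovsky's composition `ν = ν₁ ∘ ν₂`, per valuation, in the crux shape (`stub_lurel_of_composite`)

Stub of the birth line of the crux `ShadowsUniformize` (stmt-ResolutionOfSingularities-16756, route
`AbhyankarShadows`), composite-discrete branch. The crux asks for relative local uniformization in
the affine-model shape "every finitely generated `R ⊆ O` is dominated by a finitely generated
`A ⊆ O` with `Frac A = K` regular at the centre `m_O ∩ A`". This file proves the PER-VALUATION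
form of Novacoski–Spivakovsky 2014, Thm. 1.1 (§3.1, "the three steps") for a composite valuation
`ν = ν₁ ∘ ν₂` of a function field `K/k` (`k ⊆ O ≤ O₁`):

* IF `O₁` admits relative local uniformization on `K/k` in the crux shape (`h₁`), and
* IF the residue valuation ring `O / m_{O₁}` of `κ(O₁)` admits it after being read through any
  `k`-compatible SURJECTIVE `ι : κ → κ(O₁)` (`h₂`), and
* IF `κ(O₁)` is generated over `k` by the residues of finitely many elements of `O` (`hgen`),

THEN `O` admits relative local uniformization in the crux shape.

Proof (`NovacoskiSpivakovsky2014_holds`, last block, with the induction hypotheses replaced by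
`h₁`, `h₂`): first enlarge `R` by an affine model of `K` inside `O` (`exists_affineModel`, so that
every model from now on has fraction field `K`) and by the finitely many lifts `S` of `hgen` (so
that the residue field of every model above generates `κ(O₁)`, which makes the restriction map
`ι` of Cor. 2.17 surjective); then apply `novacoskiSpivakovsky2014_cor214` (fed by `h₁`),
`novacoskiSpivakovsky2014_cor217` (fed by `h₂`) and `novacoskiSpivakovsky2014_step`.

## Sources

* [NS14] J. Novacoski, M. Spivakovsky, *Reduction of local uniformization to the rank one case*,
  in: Valuation Theory in Interaction, EMS Ser. Congr. Rep. (2014) 404–431 = arXiv:1204.4751: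
  Thm. 1.1, §3.1, Cor. 2.14, Cor. 2.17. [NovacoskiSpivakovsky2014]
-/

noncomputable section

-- single-problem summit: the doubled namespace component is forced
set_option linter.dupNamespace false

open Literature.AlgebraicGeometry.Resolution IsLocalRing

namespace Summit.ResolutionOfSingularities.ResolutionOfSingularities.Theorems

/-- **Novacoski–Spivakovsky's composition, per valuation, in the crux shape.** For valuation rings
`k ⊆ O ≤ O₁` of a finitely generated extension `K/k` (`hfg`, `hk`, `hO`) with the residue
field `κ(O₁)` generated over `k` by residues of finitely many elements of `O` (`hgen`): IF `O₁`
admits relative local uniformization on `K/k` (`h₁`, crux shape) and the residue valuation ring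
`O / m_{O₁}` admits it on `κ(O₁)` read through any `k`-compatible SURJECTIVE `ι : κ → κ(O₁)` (`h₂`),
THEN `O` admits it: enlarge `R` by an affine model of `K` (`exists_affineModel`) and by the lifts
`S` (so that the residues of every model generate `κ(O₁)`, making cor217's `ι` surjective), then
`novacoskiSpivakovsky2014_cor214` (with `h₁`), `novacoskiSpivakovsky2014_cor217` (with `h₂`) and
`novacoskiSpivakovsky2014_step`. [cite: NovacoskiSpivakovsky2014, Thm. 1.1 (§3.1), Cor. 2.14, Cor. 2.17] -/
theorem stub_lurel_of_composite (k K : Type) [Field k] [Field K] [Algebra k K]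
    (hfg : (⊤ : IntermediateField k K).FG) (O O₁ : ValuationSubring K) (hO : O ≤ O₁)
    (hk : ∀ c : k, algebraMap k K c ∈ O)
    (hgen : ∃ S : Finset O, ∀ T : Subfield (IsLocalRing.ResidueField O₁),
      (∀ c : k, IsLocalRing.residue O₁ ⟨algebraMap k K c, hO (hk c)⟩ ∈ T) →
      (∀ s ∈ S, IsLocalRing.residue O₁ ⟨(s : K), hO s.2⟩ ∈ T) → T = ⊤)
    (h₁ : ∀ R : Subalgebra k K, R.FG → R.toSubring ≤ O₁.toSubring →
      ∃ (A : Subalgebra k K) (h : A.toSubring ≤ O₁.toSubring), R ≤ A ∧ A.FG ∧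
        IsFractionRing A K ∧ IsRegularLocalRing
          (Localization.AtPrime (Ideal.comap (Subring.inclusion h) (IsLocalRing.maximalIdeal O₁))))
    (h₂ : ∀ (κ : Type) [Field κ] [Algebra k κ] (ι : κ →+* IsLocalRing.ResidueField O₁),
      Function.Surjective ι →
      (∀ c : k, ι (algebraMap k κ c) = IsLocalRing.residue O₁ ⟨algebraMap k K c, hO (hk c)⟩) →
      ∀ R : Subalgebra k κ, R.FG →
        R.toSubring ≤ ((residueValuationSubring O O₁ hO).comap ι).toSubring →
        ∃ (B : Subalgebra k κ) (hB : B.toSubring ≤ ((residueValuationSubring O O₁ hO).comap ι).toSubring),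
          R ≤ B ∧ B.FG ∧ IsRegularLocalRing (Localization.AtPrime (Ideal.comap (Subring.inclusion hB)
            (IsLocalRing.maximalIdeal ((residueValuationSubring O O₁ hO).comap ι)))))
    (R : Subalgebra k K) (hR : R.FG) (hRO : R.toSubring ≤ O.toSubring) :
    ∃ (A : Subalgebra k K) (h : A.toSubring ≤ O.toSubring), R ≤ A ∧ A.FG ∧
      IsFractionRing A K ∧ IsRegularLocalRing
        (Localization.AtPrime (Ideal.comap (Subring.inclusion h) (IsLocalRing.maximalIdeal O))) := by
  classical
  -- Step 0: enlarge `R` by an affine model of `K` and by the lifts `S` of generators of `κ(O₁)`.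
  obtain ⟨Bm, hBmO, hBmfg, hBmfrac⟩ := exists_affineModel k K hfg O hk
  obtain ⟨S, hS⟩ := hgen
  let Ok : Subalgebra k K := ({ O.toSubring with algebraMap_mem' := hk } : Subalgebra k K)
  let R' : Subalgebra k K := R ⊔ Bm ⊔ Algebra.adjoin k ((S.image fun s : O => (s : K)) : Set K)
  have hR'fg : R'.FG := (hR.sup hBmfg).sup (Subalgebra.fg_adjoin_finset _)
  have hR'Ok : R' ≤ Ok := by
    refine sup_le (sup_le (fun x hx => hRO hx) (fun x hx => hBmO hx)) (Algebra.adjoin_le ?_)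
    intro x hx
    rw [Finset.coe_image] at hx
    obtain ⟨s, -, rfl⟩ := hx
    exact s.2
  have hR'O : R'.toSubring ≤ O.toSubring := fun x hx => hR'Ok hx
  have hRR' : R ≤ R' := le_sup_left.trans le_sup_left
  have hSR' : ∀ s ∈ S, (s : K) ∈ R' := by
    intro s hs
    refine (le_sup_right : Algebra.adjoin k ((S.image fun s : O => (s : K)) : Set K) ≤ R') ?_
    exact Algebra.subset_adjoin (Finset.mem_coe.mpr (Finset.mem_image_of_mem _ hs))
  haveI := hBmfrac
  have hR'frac : IsFractionRing R' K :=
    isFractionRing_subalgebra_of_le Bm R' (le_sup_right.trans le_sup_left)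
  -- Step 1 (Cor. 2.14): a model `A₁ ⊇ R'` inside `O`, regular at the centre of `ν₁`.
  have h₁' : ∃ (A₁ : Subalgebra k K) (hA₁ : A₁.toSubring ≤ O₁.toSubring), R' ≤ A₁ ∧ A₁.FG ∧
      IsRegularLocalRing
        (Localization.AtPrime ((maximalIdeal O₁).comap (Subring.inclusion hA₁))) := by
    obtain ⟨A₁, hA₁, hR'A₁, hA₁fg, -, hreg⟩ := h₁ R' hR'fg (hR'O.trans hO)
    exact ⟨A₁, hA₁, hR'A₁, hA₁fg, hreg⟩
  obtain ⟨A₁, hA₁, hR'A₁, hA₁fg, hreg₁⟩ :=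
    novacoskiSpivakovsky2014_cor214 O O₁ hO R' hR'fg hR'frac hR'O h₁'
  haveI hfrac₁ : IsFractionRing A₁ K := isFractionRing_subalgebra_of_le R' A₁ hR'A₁
  -- Step 2 (Cor. 2.17): its input from `h₂`; the restriction `ι` is surjective thanks to `S ⊆ A₁`.
  have h₂' : ∀ (κ : Type) [Field κ] [Algebra k κ] (ι : κ →+* ResidueField O₁) (φ : A₁ →ₐ[k] κ),
      (∀ a : A₁, ι (φ a) = residue O₁ ⟨(a : K), (hA₁.trans hO) a.2⟩) →
      IsFractionRing φ.range κ →
      ∃ (B : Subalgebra k κ)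
        (hB : B.toSubring ≤ ((residueValuationSubring O O₁ hO).comap ι).toSubring),
        φ.range ≤ B ∧ B.FG ∧
        IsRegularLocalRing (Localization.AtPrime
          ((maximalIdeal ((residueValuationSubring O O₁ hO).comap ι)).comap
            (Subring.inclusion hB))) := by
    intro κ _ _ ι φ hφ hfr
    -- adapted from the `ih₂'` block of `NovacoskiSpivakovsky2014_holds`
    have hfgφ : φ.range.FG := by
      have h := ((Subalgebra.fg_top A₁).mpr hA₁fg).map φ
      rwa [Algebra.map_top] at h
    have hle : φ.range.toSubring ≤ ((residueValuationSubring O O₁ hO).comap ι).toSubring := by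
      intro z hz
      obtain ⟨a, rfl⟩ := (AlgHom.mem_range φ).mp (show z ∈ φ.range from hz)
      change φ a ∈ (residueValuationSubring O O₁ hO).comap ι
      rw [ValuationSubring.mem_comap, hφ]
      exact (residue_mem_residueValuationSubring_iff O O₁ hO _).mpr (hA₁ a.2)
    -- `ι` is compatible with `k`
    have hιk : ∀ c : k, ι (algebraMap k κ c) = residue O₁ ⟨algebraMap k K c, hO (hk c)⟩ := by
      intro c
      rw [← φ.commutes c, hφ]
      rfl
    -- `ι` is surjective: its range contains `k` and the residues of `S`
    have hsurj : Function.Surjective ι := by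
      refine RingHom.fieldRange_eq_top_iff.mp (hS ι.fieldRange ?_ ?_)
      · intro c
        rw [← hιk c]
        exact RingHom.mem_fieldRange_self ι _
      · intro s hs
        have h := hφ ⟨(s : K), hR'A₁ (hSR' s hs)⟩
        exact RingHom.mem_fieldRange.mpr ⟨_, h⟩
    exact h₂ κ ι hsurj hιk φ.range hfgφ hle
  obtain ⟨A₂, hA₂, hA₁₂, hA₂fg, hreg₂, hreg₂'⟩ :=
    novacoskiSpivakovsky2014_cor217 O O₁ hO A₁ hA₁ hA₁fg hfrac₁ hreg₁ h₂'
  haveI hfrac₂ : IsFractionRing A₂ K := isFractionRing_subalgebra_of_le A₁ A₂ hA₁₂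
  -- Step 3 (§3.1): blow up to a regular model.
  obtain ⟨A₃, hA₃, hA₂₃, hA₃fg, hreg₃⟩ :=
    novacoskiSpivakovsky2014_step O O₁ hO A₂ hA₂ hA₂fg hfrac₂ hreg₂ hreg₂'
  have hfrac₃ : IsFractionRing A₃ K := isFractionRing_subalgebra_of_le A₂ A₃ hA₂₃
  exact ⟨A₃, hA₃, hRR'.trans (hR'A₁.trans (hA₁₂.trans hA₂₃)), hA₃fg, hfrac₃, hreg₃⟩

end Summit.ResolutionOfSingularities.ResolutionOfSingularities.Theorems

end
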